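import Literature.InformationTheory.QuantumCodes.AbelianTwoBlockParameters
import Mathlib.RepresentationTheory.Maschke
import Mathlib.RingTheory.SimpleModule.Basic
import HarnessLib

/-!
# Padded single-block logical operators of abelian two-block codes: when the ideal `(a, b)` of
# `F[G]` is generated by an idempotent, every non-zero `e ∈ ker A ∩ ker B` gives the non-trivial
# `Z`-logicals `(e, 0)` and `(0, e)`, so `d ≤ |e|`

Sources followed.

* H.-K. Lin, L. P. Pryadko, *Quantum two-block group algebra codes*, PRA **109** (2024) 022407 =
  arXiv:2306.16400 [LinPryadko2024]: §III.C (held text chunk p0007 L90–100) — the `Z`-punctured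
  single-block codes `css((1−E_B)A, Bᵀ)`, `css((1−E_A)B, Aᵀ)`; "In the special case `δ_X = 0` …
  This condition also guarantees that any non-trivial `Z`-codeword in one of these codes becomes a
  non-trivial codeword in the original two-block code after it is padded with zeros"; §II.A (chunk
  p0004 L98–104) and §IV.E Statement 10 (chunk p0011 L37–57) — in a SEMISIMPLE group algebra
  (`gcd(char F, |G|) = 1`, Maschke) "any ideal is a principal ideal generated by an idempotent", and
  then the rank defects vanish.
* R. Wang, L. P. Pryadko, Symmetry **14** (2022) 1348 = arXiv:2203.17216 [WangPryadko2022], §3.1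
  Statement 2 / §6.3: the CYCLIC-group version "either `[e(x),0]` or `[0,e(x)]` is a non-trivial
  `Z`-vector", `d(GB) ≤ d_g` — machine-checked for every cyclic group in
  `GBDistanceUpperBound.lean` (`GB.not_both_trivial`).

## What is PROVED here (no named facts; any commutative coefficient ring, any finite abelian `G`)

For the tree's abelian two-block pair `H_X = [A|B]`, `H_Z = [Bᵀ|Aᵀ]`, `A = circulant a`,
`B = circulant b` (`AbelianTwoBlock.HX/HZ`), write `u ⋆ v := circulant u *ᵥ v` for the product of
`F[G]` (commutative and associative: `conv_comm`, `conv_assoc`).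

* `AbelianTwoBlock.IsIdempotentGenerator a b f` — the CERTIFICATE "the ideal `(a, b)` is generated by
  the idempotent `f`": `f ⋆ f = f`, `a, b ∈ (f)`, `f ∈ (a, b)` (four `F[G]`-identities, decidable per
  code over a finite field; they EXIST for every `a, b` when `F[G]` is semisimple — LP24 §II.A /
  Statement 10 — which is not re-proved here).
* `eq_zero_of_mem_ker_of_mem_col` — the mechanism: under such a certificate, an `e` with
  `a ⋆ e = b ⋆ e = 0` which lies in the column space of `B` (or of `A`) is `0`
  (`f ⋆ e = α⋆(a⋆e) + β⋆(b⋆e) = 0` while `e = b ⋆ w = f ⋆ (c ⋆ w)` is fixed by `f`).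
* `sumElim_left_not_mem_rowSpace`, `sumElim_right_not_mem_rowSpace` — hence for `e ≠ 0` in
  `ker A ∩ ker B` BOTH padded vectors `(e, 0)` and `(0, e)` (which lie in `ker H_X`) are outside the
  row space of `H_Z` (LP24 §III.C's padding sentence, in the idempotent-generated case, for both
  blocks at once);
* `css_dZ_le_hammingNorm`, `css_dX_le_hammingNorm` — so over `𝔽₂`, `d_Z ≤ |e|` and `d_X ≤ |e|` for
  the CSS code `AbelianTwoBlock.css a b`: **`d(LP[a,b]) ≤ d(ker A ∩ ker B)`** for every abelian
  two-block code carrying an idempotent-generator certificate.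
* `exists_isIdempotentGenerator` — **the certificate EXISTS for every `a, b` whenever `F[G]` is
  semisimple** (`NeZero (Nat.card G : F)`, i.e. `char F ∤ |G|`): Mathlib's Maschke theorem
  (`IsSemisimpleRing (AddMonoidAlgebra F G)`) and `IsSemisimpleRing.ideal_eq_span_idempotent`,
  transported along "coefficient function ↔ element of `AddMonoidAlgebra F G`" (Mathlib's product =
  the circulant product) — LP24 §II.A / Statement 10 as a theorem; hence
  `sumElim_left/right_not_mem_rowSpace_of_semisimple` and, over `𝔽₂`,
  `css_dZ_le_hammingNorm_of_card_odd` / `css_dX_le_hammingNorm_of_card_odd`: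
  **`d(LP[a,b]) ≤ d(ker A ∩ ker B)` UNCONDITIONALLY for every abelian group of odd order.**
* `eq_zero_of_sumElim_mem_rowSpace`, `exists_sumElim_sub_mem_rowSpace` (+ `_of_semisimple`) —
  LP24 §IV.E "their codeword basis can be chosen so that each codeword is supported on only one
  block": under the certificate the padded pairs `(e, e')`, `e, e' ∈ ker A ∩ ker B`, are independent
  modulo `rowspace H_Z`, and in characteristic `2` (where `rowspace H_Z ≤ ker H_X` for the tree's
  sign-free `H_Z`) every `z ∈ ker H_X` is a `Z`-stabilizer plus such a pair (dimension count
  `k = 2 · dim(ker A ∩ ker B)`, `AbelianTwoBlock.rank_HX_add_finrank_ker`).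

Honest scope. (1) Without semisimplicity / a certificate the conclusion can fail for BOTH paddings of
one `e` (qec-lit-3 g4, exhaustive over `𝔽₂[ℤ₂ × ℤ₂]`; not typed) although it always holds for cyclic
`G` (`GB.not_both_trivial`); whether `d ≤ d(ker A ∩ ker B)` holds for every abelian `G` of even
order is not in print and not asserted. (2) `[[4,2,2]] = LP[1+x,1+x]` over `𝔽₂[ℤ₂]` has no
certificate (`(1+x)² = 0`) — it is covered by the cyclic theorem instead.
-/

namespace Literature.InformationTheory.QuantumCodes

namespace AbelianTwoBlock

open Matrix

section Algebra

variable {G : Type*} [AddCommGroup G] [Fintype G] {F : Type*} [CommRing F]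

/-- The group-algebra product `u ⋆ v = circulant u *ᵥ v` is commutative for abelian `G`.
[cite: LinPryadko2024, §IV.E "in the case of an abelian group G, for any a ∈ F[G], L(a) = R(a)" (arXiv:2306.16400 chunk p0011 L20–22)] -/
theorem conv_comm (u v : G → F) : circulant u *ᵥ v = circulant v *ᵥ u := by
  apply Matrix.circulant_injective
  rw [← Matrix.circulant_mul, ← Matrix.circulant_mul, Matrix.circulant_mul_comm]

/-- Associativity in the form `u ⋆ (v ⋆ w) = (u ⋆ v) ⋆ w`. [cite: LinPryadko2024, §II.A group algebra F[G] (arXiv:2306.16400 chunk p0004 L80–96)] -/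
theorem conv_assoc (u v w : G → F) :
    circulant u *ᵥ (circulant v *ᵥ w) = circulant (circulant u *ᵥ v) *ᵥ w := by
  rw [Matrix.mulVec_mulVec, Matrix.circulant_mul]

/-- If `a ⋆ e = 0` then `(a ⋆ x) ⋆ e = 0` for every `x` (annihilators are ideals).
[cite: LinPryadko2024, §II.A (arXiv:2306.16400 chunk p0004 L90–96)] -/
theorem conv_conv_eq_zero_of_conv_eq_zero {a e : G → F} (h : circulant a *ᵥ e = 0) (x : G → F) :
    circulant (circulant a *ᵥ x) *ᵥ e = 0 := by
  rw [← conv_assoc, conv_comm x e, conv_assoc, h]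
  simp

/-- **Certificate: the ideal `(a, b) ⊆ F[G]` is generated by the idempotent `f`** — `f ⋆ f = f`,
`a = f ⋆ c₁`, `b = f ⋆ c₂`, `f = a ⋆ α + b ⋆ β`. In a semisimple group algebra such an `f` exists for
every `a, b` ("any ideal is a principal ideal generated by an idempotent").
[cite: LinPryadko2024, §II.A (arXiv:2306.16400 chunk p0004 L98–104) and §IV.E Statement 10 (chunk p0011 L37–57)] -/
structure IsIdempotentGenerator (a b f : G → F) : Prop where
  /-- `f ⋆ f = f` -/
  idem : circulant f *ᵥ f = f
  /-- `a ∈ (f)` -/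
  gen_a : ∃ c, circulant f *ᵥ c = a
  /-- `b ∈ (f)` -/
  gen_b : ∃ c, circulant f *ᵥ c = b
  /-- `f ∈ (a, b)` -/
  mem : ∃ α β, circulant a *ᵥ α + circulant b *ᵥ β = f

/-- The certificate is symmetric in `a, b`. [cite: LinPryadko2024, §II.A (arXiv:2306.16400 chunk p0004 L98–104)] -/
theorem IsIdempotentGenerator.symm {a b f : G → F} (h : IsIdempotentGenerator a b f) :
    IsIdempotentGenerator b a f where
  idem := h.idem
  gen_a := h.gen_b
  gen_b := h.gen_a
  mem := by
    obtain ⟨α, β, hαβ⟩ := h.mem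
    exact ⟨β, α, by rw [add_comm, hαβ]⟩

/-- Under the certificate, `f` annihilates `ker A ∩ ker B`: `a ⋆ e = b ⋆ e = 0 ⇒ f ⋆ e = 0`.
[cite: LinPryadko2024, §III.C (arXiv:2306.16400 chunk p0007 L90–100)] -/
theorem IsIdempotentGenerator.conv_eq_zero {a b f e : G → F} (h : IsIdempotentGenerator a b f)
    (ha : circulant a *ᵥ e = 0) (hb : circulant b *ᵥ e = 0) : circulant f *ᵥ e = 0 := by
  obtain ⟨α, β, hαβ⟩ := h.mem
  rw [← hαβ, Matrix.circulant_add, Matrix.add_mulVec, conv_conv_eq_zero_of_conv_eq_zero ha,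
    conv_conv_eq_zero_of_conv_eq_zero hb, add_zero]

/-- Under the certificate, `f` fixes the column space of `B`: `e = b ⋆ w ⇒ f ⋆ e = e`.
[cite: LinPryadko2024, §II.A "J_R = e_J · F[G] … with idempotent e_J" (arXiv:2306.16400 chunk p0004 L98–104)] -/
theorem IsIdempotentGenerator.conv_eq_self_of_col {a b f e w : G → F} (h : IsIdempotentGenerator a b f)
    (he : circulant b *ᵥ w = e) : circulant f *ᵥ e = e := by
  obtain ⟨c, hc⟩ := h.gen_b
  rw [← he, ← hc, ← conv_assoc f c w, conv_assoc f f, h.idem]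

/-- **The mechanism.** Under the certificate, an element of `ker A ∩ ker B` lying in the column space
of `B` vanishes. [cite: LinPryadko2024, §III.C "any non-trivial Z-codeword in one of these codes becomes a non-trivial codeword in the original two-block code after it is padded with zeros" (arXiv:2306.16400 chunk p0007 L96–100), idempotent-generated case] -/
theorem eq_zero_of_mem_ker_of_mem_col {a b f e w : G → F} (h : IsIdempotentGenerator a b f)
    (ha : circulant a *ᵥ e = 0) (hb : circulant b *ᵥ e = 0) (he : circulant b *ᵥ w = e) : e = 0 := by
  rw [← h.conv_eq_self_of_col he, h.conv_eq_zero ha hb]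

end Algebra

/-! ### The padded vectors `(e, 0)`, `(0, e)` are non-trivial `Z`-logicals -/

section Padding

variable {G : Type*} [AddCommGroup G] [Fintype G] {F : Type*} [CommRing F]

/-- `(u, v) ∈ rowspace H_Z ↔ ∃ w, u = b ⋆ w ∧ v = a ⋆ w`, for `H_Z = [Bᵀ|Aᵀ]`.
[cite: LinPryadko2024, §III `H_Zᵀ = (B; −A)` (arXiv:2306.16400 chunk p0006 L6–10), the tree's sign-free form over any ring] -/
theorem sumElim_mem_range_vecMulLinear_HZ_iff (a b u v : G → F) :
    Sum.elim u v ∈ LinearMap.range (HZ a b).vecMulLinear ↔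
      ∃ w, circulant b *ᵥ w = u ∧ circulant a *ᵥ w = v := by
  simp only [LinearMap.mem_range, Matrix.vecMulLinear_apply, HZ_def, Matrix.vecMul_fromCols,
    Matrix.vecMul_transpose]
  constructor
  · rintro ⟨w, hw⟩
    refine ⟨w, ?_, ?_⟩
    · funext i; simpa using congr_fun hw (Sum.inl i)
    · funext i; simpa using congr_fun hw (Sum.inr i)
  · rintro ⟨w, hu, hv⟩
    exact ⟨w, by rw [hu, hv]⟩

/-- `H_X (u, v) = a ⋆ u + b ⋆ v`. [cite: LinPryadko2024, §III `H_X = (A, B)` (arXiv:2306.16400 chunk p0006 L6–10)] -/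
theorem HX_mulVec_sumElim (a b u v : G → F) :
    HX a b *ᵥ Sum.elim u v = circulant a *ᵥ u + circulant b *ᵥ v := by
  rw [HX_def, Matrix.fromCols_mulVec_sumElim]

/-- **`(e, 0)` is a non-trivial `Z`-vector** for every non-zero `e ∈ ker A ∩ ker B`, under the
certificate. [cite: LinPryadko2024, §III.C padding sentence (arXiv:2306.16400 chunk p0007 L96–100); WangPryadko2022, §3.1 Statement 2 (cyclic case, arXiv:2203.17216 chunk p0006 L100–110)] -/
theorem sumElim_left_not_mem_rowSpace {a b f e : G → F} (h : IsIdempotentGenerator a b f) (he : e ≠ 0)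
    (ha : circulant a *ᵥ e = 0) (hb : circulant b *ᵥ e = 0) :
    Sum.elim e (0 : G → F) ∉ LinearMap.range (HZ a b).vecMulLinear := by
  intro hmem
  obtain ⟨w, hw, -⟩ := (sumElim_mem_range_vecMulLinear_HZ_iff a b e 0).mp hmem
  exact he (eq_zero_of_mem_ker_of_mem_col h ha hb hw)

/-- **`(0, e)` is a non-trivial `Z`-vector** likewise (apply the mechanism to `(b, a)`).
[cite: LinPryadko2024, §III.C padding sentence (arXiv:2306.16400 chunk p0007 L96–100)] -/
theorem sumElim_right_not_mem_rowSpace {a b f e : G → F} (h : IsIdempotentGenerator a b f) (he : e ≠ 0)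
    (ha : circulant a *ᵥ e = 0) (hb : circulant b *ᵥ e = 0) :
    Sum.elim (0 : G → F) e ∉ LinearMap.range (HZ a b).vecMulLinear := by
  intro hmem
  obtain ⟨w, -, hw⟩ := (sumElim_mem_range_vecMulLinear_HZ_iff a b 0 e).mp hmem
  exact he (eq_zero_of_mem_ker_of_mem_col h.symm hb ha hw)

end Padding

/-! ### The distance bound for the CSS code over `𝔽₂` -/

section Distance

variable {G : Type*} [AddCommGroup G] [Fintype G]

/-- `|(u, v)| = |u| + |v|`. [folklore] -/
private theorem hammingNorm_sumElim {α β R : Type*} [Fintype α] [Fintype β] [Zero R] [DecidableEq R]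
    (u : α → R) (v : β → R) : hammingNorm (Sum.elim u v) = hammingNorm u + hammingNorm v := by
  unfold hammingNorm
  rw [← Finset.card_disjSum]
  congr 1
  ext i
  rcases i with i | i <;> simp [Finset.mem_disjSum]

/-- **`d_Z(LP[a,b]) ≤ |e|`** for every non-zero `e ∈ ker A ∩ ker B`, for an abelian two-block code
over `𝔽₂` carrying an idempotent-generator certificate for `(a, b)`.
[cite: LinPryadko2024, §III.C (arXiv:2306.16400 chunk p0007 L90–100) with §II.A / Statement 10 (chunks p0004 L98–104, p0011 L37–57)] -/
theorem css_dZ_le_hammingNorm {a b f e : G → ZMod 2} (h : IsIdempotentGenerator a b f) (he : e ≠ 0)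
    (ha : circulant a *ᵥ e = 0) (hb : circulant b *ᵥ e = 0) : (css a b).dZ ≤ hammingNorm e := by
  have hker : (css a b).HX *ᵥ Sum.elim e (0 : G → ZMod 2) = 0 := by
    rw [css_HX, HX_mulVec_sumElim, Matrix.mulVec_zero, add_zero, ha]
  have hw : hammingNorm (Sum.elim e (0 : G → ZMod 2)) = hammingNorm e := by
    rw [hammingNorm_sumElim, hammingNorm_zero, add_zero]
  rw [← hw]
  exact (css a b).dZ_le_hammingNorm hker (sumElim_left_not_mem_rowSpace h he ha hb)

/-- **`d_X(LP[a,b]) ≤ |e|`** likewise (`d_X = d_Z`, the tree's `css_dX_eq_dZ`).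
[cite: LinPryadko2024, §IV.B "abelian G ⇒ LP[a,b] ≅ LP[b,a] ⇒ d_X = d_Z" (arXiv:2306.16400 chunk p0009 L103–106) with §III.C (chunk p0007 L90–100)] -/
theorem css_dX_le_hammingNorm {a b f e : G → ZMod 2} (h : IsIdempotentGenerator a b f) (he : e ≠ 0)
    (ha : circulant a *ᵥ e = 0) (hb : circulant b *ᵥ e = 0) : (css a b).dX ≤ hammingNorm e := by
  rw [css_dX_eq_dZ]
  exact css_dZ_le_hammingNorm h he ha hb

end Distance

/-! ### A kernel instance of the certificate (sanity): `𝔽₂[ℤ₃]`, `a = 1 + x`, `b = x + x²` -/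

section Example

/-- Over the semisimple `𝔽₂[ℤ₃]`, `a = 1 + x = ![1,1,0]` and `b = x + x² = ![0,1,1]` generate the
augmentation ideal, whose idempotent generator is `f = x + x² = ![0,1,1]` (`f² = f`, `a = f ⋆ x²`,
`b = f ⋆ 1`, `f = a ⋆ 0 + b ⋆ 1`): the certificate holds, by `decide` — the four identities are
machine-decidable per code. [cite: LinPryadko2024, §IV.E Statement 10 (arXiv:2306.16400 chunk p0011 L37–57)] -/
theorem isIdempotentGenerator_example :
    IsIdempotentGenerator (![1, 1, 0] : ZMod 3 → ZMod 2) ![0, 1, 1] ![0, 1, 1] :=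
  ⟨by decide, ⟨![0, 0, 1], by decide⟩, ⟨![1, 0, 0], by decide⟩, ⟨![0, 0, 0], ![1, 0, 0], by decide⟩⟩

/-- … and `e = 1 + x + x² = ![1,1,1]` spans `ker A ∩ ker B`, so the `[[6, 2]]` code `LP[1+x, x+x²]` has
`d_Z ≤ 3` by `css_dZ_le_hammingNorm` (non-vacuity of the theorem; the true distance is `2`).
[cite: LinPryadko2024, §III.C (arXiv:2306.16400 chunk p0007 L90–100)] -/
theorem css_dZ_le_example : (css (![1, 1, 0] : ZMod 3 → ZMod 2) ![0, 1, 1]).dZ ≤ 3 := by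
  have h := css_dZ_le_hammingNorm (e := ![1, 1, 1]) isIdempotentGenerator_example (by decide)
    (by decide) (by decide)
  have hn : hammingNorm (![1, 1, 1] : ZMod 3 → ZMod 2) = 3 := by decide
  rw [hn] at h
  exact_mod_cast h

end Example

/-! ### Existence of the certificate for a semisimple group algebra (Maschke)

LP24 §II.A: "in a semisimple group algebra any ideal is a principal ideal generated by an
idempotent"; Statement 10 draws the consequence for abelian `G` with `gcd(char F, |G|) = 1`. Mathlib
supplies Maschke's theorem (`IsSemisimpleRing (AddMonoidAlgebra F G)` under `NeZero (Nat.card G : F)`)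
and `IsSemisimpleRing.ideal_eq_span_idempotent`; we only transport along "coefficient function ↔
element of `AddMonoidAlgebra F G`", under which Mathlib's product is the circulant product `u ⋆ v`. -/

section Existence

variable {G : Type*} [Fintype G] {F : Type*} [Field F]

/-- The element of Mathlib's group algebra `AddMonoidAlgebra F G` with coefficient function `u`.
[folklore] -/
private noncomputable def toAlg (u : G → F) : AddMonoidAlgebra F G :=
  .ofCoeff (Finsupp.equivFunOnFinite.symm u)

/-- [folklore] -/
private theorem coe_coeff_toAlg (u : G → F) : ⇑(toAlg u).coeff = u := by
  funext g
  simp [toAlg]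

variable [AddCommGroup G]

/-- Mathlib's convolution product on `AddMonoidAlgebra F G`, read on coefficient functions, is the
circulant product `u ⋆ v = circulant u *ᵥ v`. [folklore] -/
private theorem coe_coeff_mul (x y : AddMonoidAlgebra F G) :
    ⇑(x * y).coeff = circulant ⇑x.coeff *ᵥ ⇑y.coeff := by
  classical
  funext g
  have hs : ∀ {p : G × G}, p ∈ Finset.univ.image (fun h : G => (g - h, h)) ↔ p.1 + p.2 = g := by
    intro p
    simp only [Finset.mem_image, Finset.mem_univ, true_and]
    constructor
    · rintro ⟨h, rfl⟩
      exact sub_add_cancel g h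
    · intro hp
      exact ⟨p.2, by rw [← hp, add_sub_cancel_right]⟩
  rw [AddMonoidAlgebra.coeff_mul_antidiag x y g _ hs,
    Finset.sum_image (by intro h₁ _ h₂ _ h; exact (Prod.ext_iff.mp h).2)]
  simp [Matrix.mulVec, dotProduct, Matrix.circulant_apply]

/-- **In a semisimple group algebra every ideal is generated by an idempotent** (Maschke), hence for
`char F ∤ |G|` the certificate `IsIdempotentGenerator a b f` EXISTS for every `a, b : G → F`.
[cite: LinPryadko2024, §II.A "for a semisimple algebra F[G] any ideal is a principal ideal generated by an idempotent" (arXiv:2306.16400 chunk p0004 L98–104) and §IV.E Statement 10 (chunk p0011 L37–57)] -/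
theorem exists_isIdempotentGenerator [NeZero (Nat.card G : F)] (a b : G → F) :
    ∃ f, IsIdempotentGenerator a b f := by
  obtain ⟨e, he, hI⟩ := IsSemisimpleRing.ideal_eq_span_idempotent
    (Ideal.span {toAlg a, toAlg b} : Ideal (AddMonoidAlgebra F G))
  have hmem : ∀ u, toAlg u ∈ Ideal.span {toAlg a, toAlg b} →
      ∃ c, circulant (⇑e.coeff) *ᵥ c = u := by
    intro u hu
    rw [hI] at hu
    obtain ⟨r, hr⟩ := Ideal.mem_span_singleton'.mp hu
    refine ⟨⇑r.coeff, ?_⟩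
    have h := congrArg (fun z : AddMonoidAlgebra F G => ⇑z.coeff) hr
    simp only [coe_coeff_mul, coe_coeff_toAlg] at h
    rwa [conv_comm] at h
  refine ⟨⇑e.coeff, ⟨?_, hmem a (Ideal.subset_span (by simp)), hmem b (Ideal.subset_span (by simp)),
    ?_⟩⟩
  · have h := congrArg (fun z : AddMonoidAlgebra F G => ⇑z.coeff) he.eq
    simpa only [coe_coeff_mul] using h
  · have he' : e ∈ Ideal.span {toAlg a, toAlg b} := by
      rw [hI]
      exact Ideal.mem_span_singleton_self e
    obtain ⟨x, y, hxy⟩ := Ideal.mem_span_pair.mp he'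
    refine ⟨⇑x.coeff, ⇑y.coeff, ?_⟩
    have h := congrArg (fun z : AddMonoidAlgebra F G => ⇑z.coeff) hxy
    simp only [AddMonoidAlgebra.coeff_add, Finsupp.coe_add, coe_coeff_mul, coe_coeff_toAlg] at h
    rwa [conv_comm (⇑x.coeff), conv_comm (⇑y.coeff)] at h

/-- Hence for semisimple `F[G]` (`char F ∤ |G|`): for EVERY non-zero `e ∈ ker A ∩ ker B` the padded
vector `(e, 0)` is a non-trivial `Z`-logical of `LP[a,b]`.
[cite: LinPryadko2024, §IV.E Statement 10 with §III.C (arXiv:2306.16400 chunks p0011 L37–57, p0007 L90–100)] -/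
theorem sumElim_left_not_mem_rowSpace_of_semisimple [NeZero (Nat.card G : F)] {a b e : G → F}
    (he : e ≠ 0) (ha : circulant a *ᵥ e = 0) (hb : circulant b *ᵥ e = 0) :
    Sum.elim e (0 : G → F) ∉ LinearMap.range (HZ a b).vecMulLinear := by
  obtain ⟨f, hf⟩ := exists_isIdempotentGenerator a b
  exact sumElim_left_not_mem_rowSpace hf he ha hb

/-- … and so is `(0, e)`. [cite: LinPryadko2024, §IV.E Statement 10 with §III.C (arXiv:2306.16400 chunks p0011 L37–57, p0007 L90–100)] -/
theorem sumElim_right_not_mem_rowSpace_of_semisimple [NeZero (Nat.card G : F)] {a b e : G → F}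
    (he : e ≠ 0) (ha : circulant a *ᵥ e = 0) (hb : circulant b *ᵥ e = 0) :
    Sum.elim (0 : G → F) e ∉ LinearMap.range (HZ a b).vecMulLinear := by
  obtain ⟨f, hf⟩ := exists_isIdempotentGenerator a b
  exact sumElim_right_not_mem_rowSpace hf he ha hb

end Existence

/-! ### Unconditional distance bound for odd-order abelian two-block codes over `𝔽₂` -/

section OddOrder

variable {G : Type*} [AddCommGroup G] [Fintype G]

/-- **`d_Z(LP[a,b]) ≤ d(ker A ∩ ker B)` for every abelian two-block code over `𝔽₂` on a group of ODD
order** (`𝔽₂[G]` semisimple): `d_Z ≤ |e|` for every non-zero `e` with `A e = B e = 0`.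
[cite: LinPryadko2024, §IV.E Statement 10 with §III.C (arXiv:2306.16400 chunks p0011 L37–57, p0007 L90–100)] -/
theorem css_dZ_le_hammingNorm_of_card_odd (hG : Odd (Fintype.card G)) {a b e : G → ZMod 2}
    (he : e ≠ 0) (ha : circulant a *ᵥ e = 0) (hb : circulant b *ᵥ e = 0) :
    (css a b).dZ ≤ hammingNorm e := by
  haveI : NeZero (Nat.card G : ZMod 2) :=
    ⟨by rw [Nat.card_eq_fintype_card]; exact ZMod.natCast_ne_zero_iff_odd.mpr hG⟩
  obtain ⟨f, hf⟩ := exists_isIdempotentGenerator a b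
  exact css_dZ_le_hammingNorm hf he ha hb

/-- **`d_X(LP[a,b]) ≤ d(ker A ∩ ker B)`** likewise, `|G|` odd.
[cite: LinPryadko2024, §IV.E Statement 10 with §III.C and §IV.B `d_X = d_Z` (arXiv:2306.16400 chunks p0011 L37–57, p0007 L90–100, p0009 L103–106)] -/
theorem css_dX_le_hammingNorm_of_card_odd (hG : Odd (Fintype.card G)) {a b e : G → ZMod 2}
    (he : e ≠ 0) (ha : circulant a *ᵥ e = 0) (hb : circulant b *ᵥ e = 0) :
    (css a b).dX ≤ hammingNorm e := by
  rw [css_dX_eq_dZ]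
  exact css_dZ_le_hammingNorm_of_card_odd hG he ha hb

end OddOrder

/-! ### Single-block codeword basis (LP24 §IV.E)

"codes with `δ_X = δ_Z = 0` are special: their codeword basis can be chosen so that each codeword is
supported on only one block". In the tree's language, for an abelian two-block code with an
idempotent-generator certificate (in particular over a semisimple `F[G]`): the `2 · dim(ker A ∩ ker B)`
classes of the padded vectors `(e, 0)`, `(0, e')` are independent modulo the row space of `H_Z`
(`eq_zero_of_sumElim_mem_rowSpace`), and — in characteristic `2`, where `rowspace H_Z ≤ ker H_X` for
the tree's sign-free `H_Z` — every `Z`-vector `z ∈ ker H_X` is a `Z`-stabilizer plus such a pair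
(`exists_sumElim_sub_mem_rowSpace`), by the dimension count `k = 2 · dim(ker A ∩ ker B)`
(`AbelianTwoBlock.rank_HX_add_finrank_ker`). -/

section SingleBlock

variable {G : Type*} [AddCommGroup G] [Fintype G] {F : Type*} [Field F]

/-- **Independence of the single-block classes.** Under the certificate, if `(e, e')` with
`e, e' ∈ ker A ∩ ker B` lies in the row space of `H_Z` then `e = e' = 0`.
[cite: LinPryadko2024, §IV.E "their codeword basis can be chosen so that each codeword is supported on only one block" (arXiv:2306.16400 chunk p0011 L59–62) with §III.C (chunk p0007 L28–31, L90–100)] -/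
theorem eq_zero_of_sumElim_mem_rowSpace {a b f e e' : G → F} (h : IsIdempotentGenerator a b f)
    (ha : circulant a *ᵥ e = 0) (hb : circulant b *ᵥ e = 0) (ha' : circulant a *ᵥ e' = 0)
    (hb' : circulant b *ᵥ e' = 0)
    (hmem : Sum.elim e e' ∈ LinearMap.range (HZ a b).vecMulLinear) : e = 0 ∧ e' = 0 := by
  obtain ⟨w, hw, hw'⟩ := (sumElim_mem_range_vecMulLinear_HZ_iff a b e e').mp hmem
  exact ⟨eq_zero_of_mem_ker_of_mem_col h ha hb hw, eq_zero_of_mem_ker_of_mem_col h.symm hb' ha' hw'⟩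

/-- **Single-block codeword basis** (characteristic `2`). Under the certificate, every `z ∈ ker H_X`
is, modulo the row space of `H_Z`, a sum of two padded kernel vectors `(e, 0) + (0, e')`,
`e, e' ∈ ker A ∩ ker B`.
[cite: LinPryadko2024, §IV.E (arXiv:2306.16400 chunk p0011 L59–62); BravyiEtAl2024, Lemma 1 "k = 2 · dim(ker A ∩ ker B)" (arXiv:2308.07915 §4) for the dimension count] -/
theorem exists_sumElim_sub_mem_rowSpace (h2 : (2 : F) = 0) {a b f : G → F}
    (h : IsIdempotentGenerator a b f) {z : G ⊕ G → F} (hz : HX a b *ᵥ z = 0) :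
    ∃ e e' : G → F, (circulant a *ᵥ e = 0 ∧ circulant b *ᵥ e = 0) ∧
      (circulant a *ᵥ e' = 0 ∧ circulant b *ᵥ e' = 0) ∧
      z - Sum.elim e e' ∈ LinearMap.range (HZ a b).vecMulLinear := by
  classical
  set K : Submodule F (G → F) :=
    LinearMap.ker (circulant a).mulVecLin ⊓ LinearMap.ker (circulant b).mulVecLin with hK
  have hmemK : ∀ {u : G → F}, u ∈ K ↔ circulant a *ᵥ u = 0 ∧ circulant b *ᵥ u = 0 := by
    intro u
    simp [hK, LinearMap.mem_ker]
  -- the "padding" map `(e, e') ↦ (e, e')` on `K × K`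
  let E : ((G → F) × (G → F)) ≃ₗ[F] (G ⊕ G → F) := (LinearEquiv.sumArrowLequivProdArrow G G F F).symm
  let Φ : (↥K × ↥K) →ₗ[F] (G ⊕ G → F) := E.toLinearMap.comp (K.subtype.prodMap K.subtype)
  have hΦ : ∀ u v : ↥K, Φ (u, v) = Sum.elim (u : G → F) (v : G → F) := by
    intro u v
    funext i
    rcases i with i | i <;> simp [Φ, E]
  have hΦinj : Function.Injective Φ := by
    rintro ⟨u, v⟩ ⟨u', v'⟩ hEq
    rw [hΦ, hΦ] at hEq
    have hu : (u : G → F) = u' := funext fun i => by simpa using congr_fun hEq (Sum.inl i)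
    have hv : (v : G → F) = v' := funext fun i => by simpa using congr_fun hEq (Sum.inr i)
    exact Prod.ext (Subtype.ext hu) (Subtype.ext hv)
  set P : Submodule F (G ⊕ G → F) := LinearMap.range Φ with hP
  set rsZ : Submodule F (G ⊕ G → F) := LinearMap.range (HZ a b).vecMulLinear with hrsZ
  set kerX : Submodule F (G ⊕ G → F) := LinearMap.ker (HX a b).mulVecLin with hkerX
  -- P ≤ ker H_X
  have hPle : P ≤ kerX := by
    rintro _ ⟨⟨u, v⟩, rfl⟩
    rw [hkerX, LinearMap.mem_ker, Matrix.mulVecLin_apply, hΦ, HX_mulVec_sumElim,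
      (hmemK.mp u.2).1, (hmemK.mp v.2).2, add_zero]
  -- rowspace H_Z ≤ ker H_X (characteristic 2)
  have hRle : rsZ ≤ kerX := by
    rintro _ ⟨w, rfl⟩
    rw [hkerX, LinearMap.mem_ker, Matrix.mulVecLin_apply, Matrix.vecMulLinear_apply,
      ← Matrix.mulVec_transpose, Matrix.mulVec_mulVec, HX_mul_HZ_transpose_eq_zero h2,
      Matrix.zero_mulVec]
  -- P ⊓ rowspace H_Z = ⊥ (independence)
  have hdisj : Disjoint P rsZ := by
    rw [Submodule.disjoint_def]
    rintro _ ⟨⟨u, v⟩, rfl⟩ hmem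
    rw [hΦ] at hmem ⊢
    obtain ⟨hu, hv⟩ := eq_zero_of_sumElim_mem_rowSpace h (hmemK.mp u.2).1 (hmemK.mp u.2).2
      (hmemK.mp v.2).1 (hmemK.mp v.2).2 hmem
    funext i
    rcases i with i | i
    · simp [hu]
    · simp [hv]
  -- dimension count
  have hfinP : Module.finrank F P = Module.finrank F K + Module.finrank F K := by
    rw [hP, LinearMap.finrank_range_of_inj hΦinj, Module.finrank_prod]
  have hfinR : Module.finrank F rsZ = (HZ a b).rank := by
    rw [hrsZ, ← Matrix.mulVecLin_transpose, ← Matrix.rank, Matrix.rank_transpose]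
  have hfinKer : Module.finrank F kerX + (HX a b).rank = Fintype.card G + Fintype.card G := by
    have hrn := LinearMap.finrank_range_add_finrank_ker (HX a b).mulVecLin
    rw [Module.finrank_fintype_fun_eq_card, Fintype.card_sum] at hrn
    rw [hkerX, Matrix.rank]
    omega
  have hX := rank_HX_add_finrank_ker (F := F) a b
  have hZ := rank_HZ_add_finrank_ker (F := F) a b
  have hsup : Module.finrank F ↥(P ⊔ rsZ) = Module.finrank F P + Module.finrank F rsZ := by
    rw [← Submodule.finrank_sup_add_finrank_inf_eq P rsZ, hdisj.eq_bot, finrank_bot, add_zero]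
  have heq : P ⊔ rsZ = kerX := by
    apply Submodule.eq_of_le_of_finrank_eq (sup_le hPle hRle)
    rw [hsup, hfinP, hfinR]
    rw [← hK] at hX hZ
    omega
  -- conclude
  have hzmem : z ∈ P ⊔ rsZ := by
    rw [heq, hkerX, LinearMap.mem_ker, Matrix.mulVecLin_apply]
    exact hz
  obtain ⟨p, hp, r, hr, hpr⟩ := Submodule.mem_sup.mp hzmem
  obtain ⟨⟨u, v⟩, rfl⟩ := hp
  refine ⟨u, v, hmemK.mp u.2, hmemK.mp v.2, ?_⟩
  rw [← hpr, hΦ, add_sub_cancel_left]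
  exact hr

/-- The semisimple case: over `F[G]` with `char F ∤ |G|` and `char F = 2`, every `Z`-vector is a
`Z`-stabilizer plus two padded kernel vectors.
[cite: LinPryadko2024, §IV.E Statement 10 and "their codeword basis can be chosen so that each codeword is supported on only one block" (arXiv:2306.16400 chunk p0011 L37–62)] -/
theorem exists_sumElim_sub_mem_rowSpace_of_semisimple [NeZero (Nat.card G : F)] (h2 : (2 : F) = 0)
    {a b : G → F} {z : G ⊕ G → F} (hz : HX a b *ᵥ z = 0) :
    ∃ e e' : G → F, (circulant a *ᵥ e = 0 ∧ circulant b *ᵥ e = 0) ∧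
      (circulant a *ᵥ e' = 0 ∧ circulant b *ᵥ e' = 0) ∧
      z - Sum.elim e e' ∈ LinearMap.range (HZ a b).vecMulLinear := by
  obtain ⟨f, hf⟩ := exists_isIdempotentGenerator a b
  exact exists_sumElim_sub_mem_rowSpace h2 hf hz

end SingleBlock

end AbelianTwoBlock

end Literature.InformationTheory.QuantumCodes
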